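import Mathlib
import Literature.AlgebraicGeometry.Resolution.AugmentationIdeal
import Summits.ResolutionOfSingularities.ResolutionOfSingularities.Theorems.WildQuotientsWildQuotientResolutionFixedPointsGraded

/-!
# K–L twice, the seam between the two steps: the involution on the ring of `σ`-invariants

Sub-problem `ResolutionOfSingularities`, crux `WildQuotients.WildQuotientResolution`
(stmt-ResolutionOfSingularities-15640), line L1 W4.5c, RUNG V5 (`J₅`) brick B7/HP₂
(res-L1-w45c-plan-1 RULING 10:50Z; card `mu2-strata-kl-twice` of res-L1-w45c-idea-2).

For commuting `k`-algebra automorphisms `σ, τ` of `U` (`σ` of order `p`, `τ` an involution) the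
second K–L step runs on the REGULAR ring `V = U^{⟨σ⟩}` with the involution `τ̄ = τ|_V`.  This file is
the generic (Mathlib-level) part of that seam:

* `exists_restrict_fixedPoints` — `τ` restricts to a `k`-automorphism `τ̄` of `U^{⟨σ⟩}`
  (`τ̄` involutive / `≠ 1` / `τ̄ ^ 2 = 1` when `τ` is);
* `comap_map_le_radical` — extension–contraction through a module-finite extension with injective
  structure map lands in the radical (Cayley–Hamilton);
* `orbitProd_*` — the norm `N u = ∏_{i<p} σⁱ u`: `σ`-invariant (domain), `τ N u = (−1)^p N u` for
  `τ u = −u`, and `N u − u^p ∈ I_σ·U`;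
* **`comap_radical_eq_augIdeal`** — the bridge: if `τ u − u ∈ √I` for all `u` and
  `I ≤ √(I_{τ̄}·U)`, and `I_{τ̄}` is radical, then `√I ∩ V = I_{τ̄}`: the fixed locus of `τ̄` on
  `Spec V` is the image of `V(I)`.
-/

-- single-problem summit: the doubled namespace component `ResolutionOfSingularities` is forced
set_option linter.dupNamespace false

noncomputable section

open Literature.AlgebraicGeometry.Resolution
open Summit.ResolutionOfSingularities.ResolutionOfSingularities.Theorems.WildQuotientResolution.TameTransfer
  (mem_fixedPoints_zpowers_iff_apply_eq)

namespace Summit.ResolutionOfSingularities.ResolutionOfSingularities.Theorems.WildQuotientResolution.InvolutionExit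

/-! ## Restricting `τ` to the `σ`-invariants -/

section Restrict

variable {k U : Type} [Field k] [CommRing U] [Algebra k U] (σ τ : U ≃ₐ[k] U)
  (hc : ∀ u, σ (τ u) = τ (σ u))

include hc in
/-- `τ` maps `σ`-invariants to `σ`-invariants when `στ = τσ`. [folklore] -/
theorem apply_mem_fixedPoints_of_commute {u : U}
    (hu : u ∈ FixedPoints.subalgebra k U (Subgroup.zpowers σ)) :
    τ u ∈ FixedPoints.subalgebra k U (Subgroup.zpowers σ) := by
  rw [mem_fixedPoints_zpowers_iff_apply_eq] at hu ⊢
  rw [hc, hu]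

include hc in
/-- `τ⁻¹` maps `σ`-invariants to `σ`-invariants when `στ = τσ`. [folklore] -/
theorem symm_apply_mem_fixedPoints_of_commute {u : U}
    (hu : u ∈ FixedPoints.subalgebra k U (Subgroup.zpowers σ)) :
    τ.symm u ∈ FixedPoints.subalgebra k U (Subgroup.zpowers σ) := by
  rw [mem_fixedPoints_zpowers_iff_apply_eq] at hu ⊢
  apply τ.injective
  rw [← hc, τ.apply_symm_apply, hu]

include hc in
/-- **`τ` restricts to a `k`-automorphism `τ̄` of `U^{⟨σ⟩}`** when `στ = τσ`. [folklore] -/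
theorem exists_restrict_fixedPoints :
    ∃ τbar : FixedPoints.subalgebra k U (Subgroup.zpowers σ) ≃ₐ[k]
        FixedPoints.subalgebra k U (Subgroup.zpowers σ),
      ∀ v, ((τbar v : FixedPoints.subalgebra k U (Subgroup.zpowers σ)) : U) = τ v := by
  let f : FixedPoints.subalgebra k U (Subgroup.zpowers σ) →ₐ[k]
      FixedPoints.subalgebra k U (Subgroup.zpowers σ) :=
    ((τ : U →ₐ[k] U).comp (FixedPoints.subalgebra k U (Subgroup.zpowers σ)).val).codRestrict
      (FixedPoints.subalgebra k U (Subgroup.zpowers σ))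
      (fun v => apply_mem_fixedPoints_of_commute σ τ hc v.2)
  let g : FixedPoints.subalgebra k U (Subgroup.zpowers σ) →ₐ[k]
      FixedPoints.subalgebra k U (Subgroup.zpowers σ) :=
    ((τ.symm : U →ₐ[k] U).comp (FixedPoints.subalgebra k U (Subgroup.zpowers σ)).val).codRestrict
      (FixedPoints.subalgebra k U (Subgroup.zpowers σ))
      (fun v => symm_apply_mem_fixedPoints_of_commute σ τ hc v.2)
  refine ⟨AlgEquiv.ofAlgHom f g ?_ ?_, fun v => rfl⟩
  · ext v
    exact τ.apply_symm_apply (v : U)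
  · ext v
    exact τ.symm_apply_apply (v : U)

variable (τbar : FixedPoints.subalgebra k U (Subgroup.zpowers σ) ≃ₐ[k]
    FixedPoints.subalgebra k U (Subgroup.zpowers σ))
  (hτbar : ∀ v, ((τbar v : FixedPoints.subalgebra k U (Subgroup.zpowers σ)) : U) = τ v)

include hτbar in
/-- The restriction of an involution is an involution. [folklore] -/
theorem restrict_involutive (hτ : ∀ u, τ (τ u) = u) : ∀ v, τbar (τbar v) = v := fun v =>
  Subtype.ext (by rw [hτbar, hτbar, hτ])

include hτbar in
/-- The restriction of an involution squares to `1`. [folklore] -/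
theorem restrict_sq_eq_one (hτ : ∀ u, τ (τ u) = u) : τbar ^ 2 = 1 := by
  ext v
  rw [pow_two, AlgEquiv.mul_apply, AlgEquiv.one_apply, restrict_involutive σ τ τbar hτbar hτ]

include hτbar in
/-- The restriction is `≠ 1` as soon as `τ` moves some `σ`-invariant. [folklore] -/
theorem restrict_ne_one {v : U} (hv : v ∈ FixedPoints.subalgebra k U (Subgroup.zpowers σ))
    (hτv : τ v ≠ v) : τbar ≠ 1 := by
  intro h
  apply hτv
  have := hτbar ⟨v, hv⟩
  rw [h, AlgEquiv.one_apply] at this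
  exact this.symm

include hτbar in
/-- The augmentation of `τ̄` is the augmentation of `τ` on invariants: `(τ̄ v − v : U) = τ v − v`.
[folklore] -/
theorem coe_restrict_sub (v : FixedPoints.subalgebra k U (Subgroup.zpowers σ)) :
    ((τbar v - v : FixedPoints.subalgebra k U (Subgroup.zpowers σ)) : U) = τ v - v := by
  rw [AddSubgroupClass.coe_sub, hτbar]

end Restrict

/-! ## Extension–contraction through a module-finite extension -/

/-- **`J·B ∩ A ⊆ √J`** for a module-finite extension `A ⊆ B` (Cayley–Hamilton: `x ∈ J·B ∩ A` is a
root of a monic polynomial with coefficients in `J`). [cite: AtiyahMacdonald1969, Prop. 5.x]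
[folklore] -/
theorem comap_map_le_radical {A B : Type} [CommRing A] [CommRing B] [Algebra A B]
    [Module.Finite A B] (hinj : Function.Injective (algebraMap A B)) (J : Ideal A) :
    (J.map (algebraMap A B)).comap (algebraMap A B) ≤ J.radical := by
  intro x hx
  rw [Ideal.mem_comap] at hx
  let f : Module.End A B := algebraMap A (Module.End A B) x
  have hf : LinearMap.range f ≤ J • (⊤ : Submodule A B) := by
    rw [Ideal.smul_top_eq_map]
    rintro _ ⟨b, rfl⟩
    change x • b ∈ J.map (algebraMap A B)
    rw [Algebra.smul_def]
    exact Ideal.mul_mem_right _ _ hx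
  obtain ⟨q, hmonic, -, hcoeff, hq⟩ :=
    LinearMap.exists_monic_and_natDegree_eq_and_coeff_mem_pow_and_aeval_eq_zero A f J hf
  have heval : q.eval x = 0 := by
    apply hinj
    have h := hq
    rw [Polynomial.aeval_algebraMap_apply_eq_algebraMap_eval] at h
    have h1 := LinearMap.congr_fun h (1 : B)
    rw [Module.algebraMap_end_apply, LinearMap.zero_apply, ← Algebra.algebraMap_eq_smul_one] at h1
    rw [h1, map_zero]
  refine ⟨q.natDegree, ?_⟩
  rw [Polynomial.eval_eq_sum_range, Finset.sum_range_succ, hmonic.coeff_natDegree, one_mul] at heval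
  have e : x ^ q.natDegree = -∑ i ∈ Finset.range q.natDegree, q.coeff i * x ^ i := by
    linear_combination heval
  rw [e]
  refine Submodule.neg_mem _ (Ideal.sum_mem _ fun i hi => Ideal.mul_mem_right _ _ ?_)
  have hlt : i < q.natDegree := Finset.mem_range.mp hi
  exact Ideal.pow_le_self (by omega) (hcoeff i)

/-! ## The orbit product (norm) `∏_{i<p} σⁱ u` -/

section Norm

variable {k U : Type} [Field k] [CommRing U] [Algebra k U] (σ : U ≃ₐ[k] U) (p : ℕ)

/-- `σ (∏_{i<p} σⁱ u) = ∏_{i<p} σⁱ u` when `σ ^ p = 1` (in a domain). [folklore] -/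
theorem apply_orbitProd_eq [IsDomain U] (hσp : σ ^ p = 1) (u : U) :
    σ (∏ i ∈ Finset.range p, (σ ^ i) u) = ∏ i ∈ Finset.range p, (σ ^ i) u := by
  by_cases hu : u = 0
  · subst hu
    rcases Nat.eq_zero_or_pos p with rfl | hp
    · simp
    · have h0 : ∏ i ∈ Finset.range p, (σ ^ i) (0 : U) = 0 :=
        Finset.prod_eq_zero (Finset.mem_range.mpr hp) (by rw [map_zero])
      rw [h0, map_zero]
  rw [map_prod]
  have e1 : ∏ i ∈ Finset.range p, σ ((σ ^ i) u) = ∏ i ∈ Finset.range p, (σ ^ (i + 1)) u :=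
    Finset.prod_congr rfl fun i _ => by rw [pow_succ', AlgEquiv.mul_apply]
  rw [e1]
  apply mul_right_cancel₀ hu
  have e2 := Finset.prod_range_succ' (fun i => (σ ^ i) u) p
  have e3 := Finset.prod_range_succ (fun i => (σ ^ i) u) p
  simp only [pow_zero, AlgEquiv.one_apply] at e2
  rw [hσp, AlgEquiv.one_apply] at e3
  rw [← e2, e3]

/-- The orbit product of `u` is `σ`-invariant (`σ ^ p = 1`, domain). [folklore] -/
theorem orbitProd_mem_fixedPoints [IsDomain U] (hσp : σ ^ p = 1) (u : U) :
    (∏ i ∈ Finset.range p, (σ ^ i) u) ∈ FixedPoints.subalgebra k U (Subgroup.zpowers σ) := by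
  rw [mem_fixedPoints_zpowers_iff_apply_eq]
  exact apply_orbitProd_eq σ p hσp u

/-- Iterates commute with a commuting automorphism. [folklore] -/
theorem pow_apply_comm (τ : U ≃ₐ[k] U) (hc : ∀ u, σ (τ u) = τ (σ u)) (i : ℕ) (u : U) :
    (σ ^ i) (τ u) = τ ((σ ^ i) u) := by
  induction i with
  | zero => simp
  | succ i ih => rw [pow_succ', AlgEquiv.mul_apply, AlgEquiv.mul_apply, ih, hc]

/-- `τ (∏_{i<p} σⁱ u) = (−1)^p ∏_{i<p} σⁱ u` for `τ u = −u` and `στ = τσ`. [folklore] -/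
theorem apply_orbitProd_of_anti (τ : U ≃ₐ[k] U) (hc : ∀ u, σ (τ u) = τ (σ u)) {u : U}
    (hu : τ u = -u) :
    τ (∏ i ∈ Finset.range p, (σ ^ i) u) = (-1) ^ p * ∏ i ∈ Finset.range p, (σ ^ i) u := by
  rw [map_prod]
  have e : ∏ i ∈ Finset.range p, τ ((σ ^ i) u) = ∏ i ∈ Finset.range p, -((σ ^ i) u) :=
    Finset.prod_congr rfl fun i _ => by rw [← pow_apply_comm σ τ hc, hu, map_neg]
  rw [e, Finset.prod_neg, Finset.card_range]

/-- `σⁱ u − u ∈ I_σ`. [folklore] -/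
theorem pow_apply_sub_mem_augIdeal (i : ℕ) (u : U) : (σ ^ i) u - u ∈ augIdeal σ := by
  induction i with
  | zero => simp
  | succ i ih =>
    have e : (σ ^ (i + 1)) u - u = (σ ((σ ^ i) u) - (σ ^ i) u) + ((σ ^ i) u - u) := by
      rw [pow_succ', AlgEquiv.mul_apply]; ring
    rw [e]
    exact add_mem (sub_mem_augIdeal σ _) ih

/-- **`∏_{i<p} σⁱ u ≡ u^p (mod I_σ)`.** [folklore] -/
theorem orbitProd_sub_pow_mem_augIdeal (u : U) :
    (∏ i ∈ Finset.range p, (σ ^ i) u) - u ^ p ∈ augIdeal σ := by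
  rw [← Ideal.Quotient.eq, map_prod, map_pow,
    Finset.prod_congr rfl (fun i _ => Ideal.Quotient.eq.mpr (pow_apply_sub_mem_augIdeal σ i u)),
    Finset.prod_const, Finset.card_range]

end Norm

/-! ## The bridge: the fixed locus of `τ̄` on `Spec U^{⟨σ⟩}` is the image of `V(I)` -/

section Bridge

variable {k U : Type} [Field k] [CommRing U] [Algebra k U] (σ τ : U ≃ₐ[k] U)
  (τbar : FixedPoints.subalgebra k U (Subgroup.zpowers σ) ≃ₐ[k]
    FixedPoints.subalgebra k U (Subgroup.zpowers σ))
  (hτbar : ∀ v, ((τbar v : FixedPoints.subalgebra k U (Subgroup.zpowers σ)) : U) = τ v)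

include hτbar in
/-- `I_{τ̄} ⊆ I ∩ V` as soon as `τ u − u ∈ I` for all `u`. [folklore] -/
theorem augIdeal_restrict_le_comap (I : Ideal U) (h1 : ∀ u, τ u - u ∈ I) :
    augIdeal τbar ≤ I.comap (algebraMap (FixedPoints.subalgebra k U (Subgroup.zpowers σ)) U) := by
  rw [augIdeal_def]
  refine Ideal.span_le.2 ?_
  rintro _ ⟨v, rfl⟩
  rw [SetLike.mem_coe, Ideal.mem_comap]
  change ((τbar v - v : FixedPoints.subalgebra k U (Subgroup.zpowers σ)) : U) ∈ I
  rw [coe_restrict_sub σ τ τbar hτbar]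
  exact h1 v

include hτbar in
/-- **The bridge.** If `τ u − u ∈ √I` for all `u ∈ U`, `I ⊆ √(I_{τ̄}·U)`, `U` is module-finite over
`V = U^{⟨σ⟩}` and `I_{τ̄}` is radical, then `√I ∩ V = I_{τ̄}`: the closed set `V(I_{τ̄}) ⊆ Spec V`
(the fixed locus of `τ̄`) is the image of `V(I) ⊆ Spec U`. [OURS · L1 W4.5c] -/
theorem comap_radical_eq_augIdeal
    [Module.Finite (FixedPoints.subalgebra k U (Subgroup.zpowers σ)) U]
    (hrad : (augIdeal τbar).IsRadical) (I : Ideal U) (h1 : ∀ u, τ u - u ∈ I.radical)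
    (h2 : I ≤ ((augIdeal τbar).map
      (algebraMap (FixedPoints.subalgebra k U (Subgroup.zpowers σ)) U)).radical) :
    I.radical.comap (algebraMap (FixedPoints.subalgebra k U (Subgroup.zpowers σ)) U) =
      augIdeal τbar := by
  have hinj : Function.Injective
      (algebraMap (FixedPoints.subalgebra k U (Subgroup.zpowers σ)) U) := Subtype.val_injective
  apply le_antisymm
  · intro x hx
    rw [Ideal.mem_comap] at hx
    have hx' : algebraMap _ U x ∈ ((augIdeal τbar).map
        (algebraMap (FixedPoints.subalgebra k U (Subgroup.zpowers σ)) U)).radical := by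
      have hle := Ideal.radical_mono h2
      rw [Ideal.radical_idem] at hle
      exact hle hx
    have hx'' : x ∈ (((augIdeal τbar).map
        (algebraMap (FixedPoints.subalgebra k U (Subgroup.zpowers σ)) U)).comap
        (algebraMap (FixedPoints.subalgebra k U (Subgroup.zpowers σ)) U)).radical := by
      rw [← Ideal.comap_radical]; exact hx'
    have h := Ideal.radical_mono (comap_map_le_radical hinj (augIdeal τbar)) hx''
    rwa [Ideal.radical_idem, hrad.radical] at h
  · exact augIdeal_restrict_le_comap σ τ τbar hτbar _ h1

end Bridge

end Summit.ResolutionOfSingularities.ResolutionOfSingularities.Theorems.WildQuotientResolution.InvolutionExit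

end
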